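import Summits.AtomisticToContinuum.Crystallization.Theorems.FrustratedLawDichotomyStrainedPatchHomExteriorLeaf

/-!
# An EXACT 3 × 3 direction-floor certificate `psd3` for the exterior leaf (drop-in for `gersh3`)
# (27623 `(H) HomFloor`, hcp half; hand-1 g40; hand-2 #13 `…HomExteriorLeaf.gersh3` / `exteriorOK`, critic row 1474 (C) (s2′)/(s4))

`…HomExteriorLeaf.gersh3 D lam lmin` certifies `(lmin/SC)‖v‖² ≤ (lam/SC)‖v‖² + Σ_ij (D_ij/SC) v_i v_j` by Gershgorin discs.  On the production anisotropy
matrix `DX = [[7,0,0],[0,6,4],[0,4,33]]·SC` Gershgorin gives the floor `lam + 2·SC` while `λ_min(DX) = 5.42·SC`: a factor 2.7 on the direction floor, i.e. on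
the exterior certificate's domination radius `ρ_dom = (4/3)(S₇♯ + f₀ + |R|·6⁻⁷)/ℓmin` (hand-1 g40 NOTE: 1.03e-2 → 4.1e-3 at the G70 anchor).  This file gives the
EXACT test (integer LDLᵀ / completed squares on the symmetrised matrix `A = D + Dᵀ + 2(lam − lmin)·1`):

* `psd3 D lam lmin : Bool` — `a := A₀₀ > 0`, `B₁₁ := a·A₁₁ − A₀₁² > 0`, `B₁₁·B₂₂ − B₁₂² ≥ 0` (`B` = `a ×` the Schur complement);
* ★ `psd3_sound` — EXACTLY the conclusion shape of `gersh3_sound` (so `extChainOK`'s `&& gersh3 …` can become `&& (gersh3 … || psd3 …)` with a one-line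
  soundness edit); proof = the polynomial identity `a·B₁₁·Q = B₁₁(a x + A₀₁ y + A₀₂ z)² + (B₁₁ y + B₁₂ z)² + (B₁₁B₂₂ − B₁₂²) z²` (`quadForm3_nonneg`, checked by `ring`).

Def + soundness; 0 sorry; standard axioms; no instances / notation / `#eval`.  `--supports stmt-AtomisticToContinuum-27623`.
-/

noncomputable section

namespace Summit.AtomisticToContinuum.Crystallization.Theorems.FrustratedLawDichotomyStrainedPatchHomExteriorRay

open scoped BigOperators RealInnerProductSpace
open Literature.Analysis.ValidatedNumerics.Numerics
open Summit.AtomisticToContinuum.Crystallization.Theorems.ChargedEnergyGapNegative (E3)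

/-! ## §1 The symmetrised matrix and the integer LDLᵀ test -/

/-- Symmetrised, shifted matrix `A_ij = D_ij + D_ji + 2(lam − lmin)·δ_ij` (integers). -/
def psdA (D : Fin 3 → Fin 3 → ℤ) (lam lmin : ℤ) (i j : Fin 3) : ℤ :=
  D i j + D j i + (if i = j then 2 * (lam - lmin) else 0)

/-- ★ **EXACT 3 × 3 FLOOR TEST** (completed squares with integer pivots): `A₀₀ > 0`, `a·A₁₁ − A₀₁² > 0`,
`(a·A₁₁ − A₀₁²)(a·A₂₂ − A₀₂²) − (a·A₁₂ − A₀₁A₀₂)² ≥ 0` with `a = A₀₀`, `A = psdA D lam lmin`. -/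
def psd3 (D : Fin 3 → Fin 3 → ℤ) (lam lmin : ℤ) : Bool :=
  let a := psdA D lam lmin 0 0
  let a01 := psdA D lam lmin 0 1
  let a02 := psdA D lam lmin 0 2
  let b11 := a * psdA D lam lmin 1 1 - a01 * a01
  let b12 := a * psdA D lam lmin 1 2 - a01 * a02
  let b22 := a * psdA D lam lmin 2 2 - a02 * a02
  decide (0 < a) && decide (0 < b11) && decide (0 ≤ b11 * b22 - b12 * b12)

/-! ## §2 ★ Soundness in the `gersh3_sound` shape -/

/-- Completed squares for a symmetric 3 × 3 form with pivots `a > 0`, `b₁₁ = a·a₁₁ − a₀₁² > 0` and `b₁₁b₂₂ − b₁₂² ≥ 0`: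
`a·b₁₁·Q = b₁₁(a x + a₀₁ y + a₀₂ z)² + (b₁₁ y + b₁₂ z)² + (b₁₁ b₂₂ − b₁₂²) z²`, hence `Q ≥ 0`. [arithmetic] -/
theorem quadForm3_nonneg (a a01 a02 a11 a12 a22 : ℝ) (ha : 0 < a) (hb : 0 < a * a11 - a01 * a01)
    (hdet : 0 ≤ (a * a11 - a01 * a01) * (a * a22 - a02 * a02) - (a * a12 - a01 * a02) * (a * a12 - a01 * a02)) (x y z : ℝ) :
    0 ≤ a * (x * x) + a01 * (x * y) + a02 * (x * z) + (a01 * (y * x) + a11 * (y * y) + a12 * (y * z)) + (a02 * (z * x) + a12 * (z * y) + a22 * (z * z)) := by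
  have hid : a * (a * a11 - a01 * a01) *
      (a * (x * x) + a01 * (x * y) + a02 * (x * z) + (a01 * (y * x) + a11 * (y * y) + a12 * (y * z)) + (a02 * (z * x) + a12 * (z * y) + a22 * (z * z))) =
      (a * a11 - a01 * a01) * (a * x + a01 * y + a02 * z) ^ 2 + ((a * a11 - a01 * a01) * y + (a * a12 - a01 * a02) * z) ^ 2 +
      ((a * a11 - a01 * a01) * (a * a22 - a02 * a02) - (a * a12 - a01 * a02) * (a * a12 - a01 * a02)) * z ^ 2 := by
    ring
  have hpos : 0 < a * (a * a11 - a01 * a01) := mul_pos ha hb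
  have hr : 0 ≤ a * (a * a11 - a01 * a01) *
      (a * (x * x) + a01 * (x * y) + a02 * (x * z) + (a01 * (y * x) + a11 * (y * y) + a12 * (y * z)) + (a02 * (z * x) + a12 * (z * y) + a22 * (z * z))) := by
    rw [hid]
    have t1 : 0 ≤ (a * a11 - a01 * a01) * (a * x + a01 * y + a02 * z) ^ 2 := mul_nonneg hb.le (sq_nonneg _)
    have t2 : 0 ≤ ((a * a11 - a01 * a01) * y + (a * a12 - a01 * a02) * z) ^ 2 := sq_nonneg _
    have t3 : 0 ≤ ((a * a11 - a01 * a01) * (a * a22 - a02 * a02) - (a * a12 - a01 * a02) * (a * a12 - a01 * a02)) * z ^ 2 :=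
      mul_nonneg hdet (sq_nonneg _)
    linarith
  by_contra hneg
  have hneg' := lt_of_not_ge hneg
  have := mul_neg_of_pos_of_neg hpos hneg'
  linarith

set_option maxHeartbeats 800000 in
/-- ★ **SOUNDNESS OF `psd3`**: `psd3 D lam lmin` ⟹ `(lmin/SC)‖v‖² ≤ (lam/SC)‖v‖² + Σ_ij (D_ij/SC) v_i v_j` for EVERY `v` — verbatim the statement of
`gersh3_sound`. [folklore: the form of the symmetrised matrix `A = D + Dᵀ + 2(lam − lmin)·1` is twice `Σ D_ij v_i v_j + (lam − lmin)‖v‖²`; `quadForm3_nonneg`] -/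
theorem psd3_sound {D : Fin 3 → Fin 3 → ℤ} {lam lmin : ℤ} (h : psd3 D lam lmin = true) (v : E3) :
    (lmin : ℝ) / SC * ‖v‖ ^ 2 ≤ (lam : ℝ) / SC * ‖v‖ ^ 2 + ∑ i : Fin 3, ∑ j : Fin 3, (D i j : ℝ) / SC * (v i * v j) := by
  have hS : (0 : ℝ) < SC := SC_pos
  simp only [psd3, psdA, Bool.and_eq_true, decide_eq_true_eq] at h
  simp only [Fin.isValue, ↓reduceIte, show (0 : Fin 3) ≠ 1 by decide, show (0 : Fin 3) ≠ 2 by decide, show (1 : Fin 3) ≠ 2 by decide,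
    add_zero] at h
  obtain ⟨⟨ha, hb⟩, hdet⟩ := h
  have ha' : (0 : ℝ) < (D 0 0 : ℝ) + D 0 0 + 2 * (lam - lmin) := by
    have h' := (Int.cast_lt (R := ℝ)).2 ha; push_cast at h'; linarith
  have hb' : (0 : ℝ) < ((D 0 0 : ℝ) + D 0 0 + 2 * (lam - lmin)) * ((D 1 1 : ℝ) + D 1 1 + 2 * (lam - lmin)) -
      ((D 0 1 : ℝ) + D 1 0) * ((D 0 1 : ℝ) + D 1 0) := by
    have h' := (Int.cast_lt (R := ℝ)).2 hb; push_cast at h'; linarith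
  have hdet' : (0 : ℝ) ≤ (((D 0 0 : ℝ) + D 0 0 + 2 * (lam - lmin)) * ((D 1 1 : ℝ) + D 1 1 + 2 * (lam - lmin)) - ((D 0 1 : ℝ) + D 1 0) * ((D 0 1 : ℝ) + D 1 0)) *
        (((D 0 0 : ℝ) + D 0 0 + 2 * (lam - lmin)) * ((D 2 2 : ℝ) + D 2 2 + 2 * (lam - lmin)) - ((D 0 2 : ℝ) + D 2 0) * ((D 0 2 : ℝ) + D 2 0)) -
      (((D 0 0 : ℝ) + D 0 0 + 2 * (lam - lmin)) * ((D 1 2 : ℝ) + D 2 1) - ((D 0 1 : ℝ) + D 1 0) * ((D 0 2 : ℝ) + D 2 0)) *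
        (((D 0 0 : ℝ) + D 0 0 + 2 * (lam - lmin)) * ((D 1 2 : ℝ) + D 2 1) - ((D 0 1 : ℝ) + D 1 0) * ((D 0 2 : ℝ) + D 2 0)) := by
    have h' := (Int.cast_le (R := ℝ)).2 hdet; push_cast at h'; linarith
  have hQ := quadForm3_nonneg _ _ _ _ _ _ ha' hb' hdet' (v 0) (v 1) (v 2)
  have hn : ‖v‖ ^ 2 = v 0 ^ 2 + v 1 ^ 2 + v 2 ^ 2 := by
    rw [EuclideanSpace.norm_eq, Real.sq_sqrt (Finset.sum_nonneg fun i _ => sq_nonneg _), Fin.sum_univ_three]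
    simp [Real.norm_eq_abs, sq_abs]
  simp only [Fin.sum_univ_three]
  rw [hn]
  have key : (lmin : ℝ) * (v 0 ^ 2 + v 1 ^ 2 + v 2 ^ 2) ≤ (lam : ℝ) * (v 0 ^ 2 + v 1 ^ 2 + v 2 ^ 2) +
      ((D 0 0 : ℝ) * (v 0 * v 0) + (D 0 1 : ℝ) * (v 0 * v 1) + (D 0 2 : ℝ) * (v 0 * v 2) +
       ((D 1 0 : ℝ) * (v 1 * v 0) + (D 1 1 : ℝ) * (v 1 * v 1) + (D 1 2 : ℝ) * (v 1 * v 2)) +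
       ((D 2 0 : ℝ) * (v 2 * v 0) + (D 2 1 : ℝ) * (v 2 * v 1) + (D 2 2 : ℝ) * (v 2 * v 2))) := by
    nlinarith [hQ]
  have := div_le_div_of_nonneg_right key hS.le
  have e : ∀ x y : ℝ, (x * y) / SC = x / SC * y := fun x y => by ring
  simp only [add_div, e] at this
  simpa only [e] using this

end Summit.AtomisticToContinuum.Crystallization.Theorems.FrustratedLawDichotomyStrainedPatchHomExteriorRay
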